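import Summits.ValiantsHypothesis.ValiantsHypothesis.Theses.DivisionGap
import Summits.ValiantsHypothesis.ValiantsHypothesis.Theorems.PerDivisionHard.Negative.LoadBearing
import Literature.Computability.AlgebraicComplexity.PermanentIrreducible
import Literature.Computability.AlgebraicComplexity.StandardFamiliesProofs
import Literature.Computability.AlgebraicComplexity.RankOneDeterminantalExpressionsProofs

/-!
# Disproof of `PerCofactorDegreeReduction` — findings of the standing disprover
# (crux `stmt-ValiantsHypothesis-15046`, route `DivisionGap`, line `Sketch`; cycle 1, 2026-08-16)

Crux (PCDR): `∃ k, ∀ n, ∀ h : ℝ≥0[x_ij] (n × n), h ≠ 0 → ∃ h' ≠ 0,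
  deg h' ≤ B ∧ L⁺(per_n · h') ≤ B`, `B = 2 ^ ((log₂ n + log₂ L⁺(per_n · h) + k) ^ k)`,
`L⁺ = Literature.Computability.AlgebraicComplexity.complexity` over `ℝ≥0` (monotone circuits).
Faithful (W.lean rc 0; read-back agrees with the two earlier refuter passes on the item): no junk
(`Nat.log 2 0 = 0` only at `L⁺ = 0`, i.e. `n ≤ 1`, where `h' = 1` works), thresholds quasi-polynomial
in `(n, s)` on both degree and size, `∃ k ∀ n` absorbs every finite set of `n`.

## VERDICT (cycle 1): NO KILL, NOT MISSTATED; SIX NEGATIVE LEMMAS CHECKED (all sorry-free below) —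
## three about the crux and its line's open stubs (the PRICE OF A KILL), three about the line's
## provable stubs (TIGHTNESS / LOAD-BEARING hypotheses, with explicit witnesses at n = 2, 3).

### (a) Load-bearing analysis of the crux  (§ KillCost)
* `pcdr_iff_uniform_witness` — the witness `h'` may be chosen depending on `n` ONLY (the bound is
  monotone in `s = L⁺(per_n·h)`, minimised at the monotone exclusion complexity `E_n`): the crux is a
  statement about one function `n ↦ (E_n, cheapest multiple of degree ≤ qp(n, E_n))`.
* `pcdr_without_witness_nonzero` — `h' ≠ 0` deleted ⇒ TRIVIAL (`h' = 0`).  [any proof must USE h' ≠ 0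
  only in the sense that it is the content]
* `not_perMultiplesHard_of_pcdr_without_nonzero` — `h ≠ 0` deleted ⇒ the statement says "per_n has a
  nonzero multiple of quasi-polynomial degree and monotone cost for every n" ⇒ `¬ PerMultiplesHard`.
  So `h ≠ 0` is load-bearing modulo H1 (as the 07:52Z crux-attack found; re-checked here inline).
* No threshold `n₀` is missing (`∃ k ∀ n ≡ ∃ k n₀ ∀ n ≥ n₀`, E.lean of the 07:52Z pass: small `n` are
  absorbed by `h' = 1`, `L⁺(per_n) ≤ (n+1)!`).

### (b) The price of a kill — WHY THE CRUX RESISTS every cheap attack  (§ KillCost)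
* `two_pow_lt_complexity_perPoly_of_not_pcdr`, `…_io_…`, `two_pow_lt_factorial_of_not_pcdr`:
  **¬PCDR ⇒ for every k and arbitrarily large n there is a nonzero h with
  `2 ^ ((log₂ n + log₂ L⁺(per_n·h) + k)^k) < L⁺(per_n) ≤ (n+1)!`** (the witness `h' = 1` must fail),
  i.e. a monotone circuit of size `2^{O((n log₂ n)^{1/k})}` for a nonzero multiple of `per_n`.
  Nothing of size `2^{o(n)}` is known for ANY multiple of the permanent (Jerrum–Snir 1982 §4.3:
  `L⁺(per_n) = n(2^{n-1} − 1)`; Hrubeš–Yehudayoff 2021 §6 Problem 2 / Open Problem 3; Jukna 2023 §6.5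
  Problem 4).  After complexification such an `h` bounds the exclusion complexity `EC_ℂ(per_n)`, and
  Bürgisser 2004 Thm 1.3 (`Cruxes/PerMultiplesHard/Disproof.lean §Exclusion`,
  `ExclusionControlsBorderDc`) turns it into border determinantal/circuit size `2^{n^{o(1)}}` for
  `per_n` infinitely often.  COMPARISON: a kill of `PerMultiplesHard` needs a QUASI-POLYNOMIAL multiple
  (refutes qp-Mulmuley–Sohoni); a kill of PCDR needs only a SUB-EXPONENTIAL one (refutes an
  exponential border lower bound for per).  PCDR is therefore the most exposed statement of the H1
  programme — but the exposure is an exponential-hardness question about `per`, not reachable by small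
  models, degenerate parameters or computation: at every FIXED n the witness `h' = 1` works as soon as
  `k ≥ k(n)`.
* `two_pow_lt_complexity_perPoly_of_not_creationDegree` (K1, test `A = per_n`) and
  `two_pow_lt_complexity_perPoly_of_not_cheapPositivization` (K2, test `p = per_n`): the two OPEN stubs
  of line `Sketch` have exactly the same price — a kill exhibits a nonzero NONNEGATIVE element `A` of the
  ideal `(per_n) ⊂ ℝ[x]` with `L⁺(A) < 2^{(log₂ L⁺(per_n))^{1/k}}` (K2: `… + log₂ deg A` inside).  Such
  `A` may have a SIGNED cofactor (e.g. `a³ + b³ = per₂ · (a² − ab + b²)`), so K2-kills are not excluded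
  by `PerMultiplesHard`; they are excluded by exponential EXCLUSION hardness of `per` (same bridge).

### (c) Line `Sketch` — the provable stubs: truth, tightness, load-bearing hypotheses
* `stub_automaticPositivity` (`deg q ≤ n+1 ∧ per_n·q ≥ 0 ⇒ q ≥ 0`): TRUE.  Paper proof (independent
  re-derivation, agrees with the card): if `q_m < 0` with `|supp m| ≤ deg m ≤ n+1`, sort rows by
  ascending `m`-degree; the `k` smallest row-degrees sum to `≤ k(n+1)/n < k+1`, so the top `k` rows have
  `≤ k` neighbour columns; this nested Hall chain orders rows/columns so that every cell of `supp m`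
  lies weakly right of the diagonal; for the diagonal matching `σ` of that order, `σ` is the UNIQUE
  permutation below `σ + m`, hence `(per·q)_{σ+m} = q_m < 0`.  Contradiction.
  **TIGHT** (`not_automaticPositivity_add_two`, § AutomaticPositivityTight): window `n+2` FALSE at
  `n = 2`, `q = a² − ab + b²`, `per₂ q = a³ + b³`.  Paper, all `n ≥ 2`: `d*(n) = n + 2` exactly — the
  exponent `m = x₀₀⋯x_{n−3,n−3}·(x_{n−2,n−2}x_{n−2,n−1}x_{n−1,n−2}x_{n−1,n−1})` has, for EVERY `σ`, a second
  permutation `τ(σ) ≤ σ + m` (if `σ` fixes the diagonal part, swap inside the block; else follow the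
  displaced rows into the block), and `q = Σ_σ x^{m+σ−τ(σ)} − ε x^m` is a signed cofactor of degree
  `n + 2` with `per_n · q ≥ 0` for `ε ≤ 1`.  So K2's hypothesis `n + 2 ≤ deg q` starts exactly at the
  first signed degree: no slack either way.  KERNEL-CHECKED ALSO AT n = 3 (§ SignedCofactorThree,
  `Three.exists_signed_cofactor_three`): `q3 = x₁₂x₂₁(per₃ − x^{id}) + x₀₀x₁₁²x₂₂² − x₀₀x₁₁x₁₂x₂₁x₂₂`,
  via the subtraction-free identity `per₃ · Σ_σ M_σ = (x₀₀x₁₁²x₂₂² R_a + x₁₂x₂₁ R_id²) + per₃ · x^m`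
  — the general mechanism `per_n(Σ_σ M_σ − x^m) = Σ_σ M_σ (per_n − x^{τ(σ)})` at work.
  NO PÓLYA SHORTCUT for K2 (`not_polya_positivizer`): the universal cheap multiplier `(Σ_v x_v)^N`
  never positivizes `q = a² − ab + b²` (coefficient `−1` at `x₀₀^{N+1}x₁₁x₁₀x₀₁` for every `N`: `q`
  vanishes at a vertex of the simplex), although `per₂` does; positivizers must be adapted to `q` —
  more precisely every positivizer `p` of this `q` has all its `x₀₀`-extremal monomials divisible by
  `x₁₁` (paper: compare the second `x₀₀`-layer of `p·q`).
* `stub_twoTowerCollapse`: plausible TRUE as stated (valuations in the UFD `ℂ[x]/(per_n)`, tree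
  `permQuot_isDomain_and_ufm`).  Disprover's remarks for the prover: (i) `hV₁ : V₁ ≠ 0`, `hV₂ : V₂ ≠ 0`
  are UNNECESSARY (if `V₁ = 0` then `per ∣ V₂ u'^N` gives disjunct 2 or, with `c = 1`, disjunct 3);
  (ii) `hn : 3 ≤ n` is PROBABLY unnecessary: at `n = 2` the quadric `Z(per₂) ≅ ℙ¹ × ℙ¹` is smooth with
  `Pic = ℤ²` and a prime divisor of multiplicity `≥ N` inside a divisor of class `(d,d)`, `d < N`, is
  impossible, so `div u = div u'` and the collapse goes through; `n ≤ 1` is trivial; (iii) the FOUR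
  HOMOGENEITY hypotheses look unnecessary as well: UFM is a property of the whole ring `S = ℂ[x]/(per_n)`,
  `S` is graded (per is a form) so `deg(fg) = deg f + deg g` for the top-degree filtration, non-units
  have degree `≥ 1`, hence `v_π(V̄ᵢ) ≤ deg Vᵢ < N` for every prime `π` and the valuation argument runs
  verbatim for inhomogeneous `u, u', Vᵢ`; units are scalars, and `c` is real by complex conjugation.
  So the stub the line needs is just `deg V₁ < N → deg V₂ < N → per ∣ V₁u^N + V₂u'^N → (disjuncts)`.
  **LOAD-BEARING: the strict `deg Vᵢ < N`** (`twoTowerCollapse_false_without_strict`, `…_odd`,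
  § TwoTowerStrict): with `≤ N` the stub is FALSE at `n = 3`, `N = 1` AND at `N = 3` (genuine cubic
  towers `x₀₀³u³ + x₁₀³u'³ ∈ (per₃)`), witnesses `u = x₀₀P₀₀ + x₂₀P₂₀`, `u' = x₀₀P₁₀` from the positive
  relation `x₀₀u + x₁₀u' = x₀₀·per₃` (support splitting of a nonnegative multiple).  Mechanism to keep in
  mind on the K1 side: positive two-term relations in `(per)` with NEITHER term in `(per)` are cheap and
  plentiful at the threshold `deg V = N`.
* `stub_squareDescent`: TRUE (`(per_n)` is a real prime ideal: `per_n` irreducible and sign-changing).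
  Its cubic analogue is FALSE (`not_cubeDescent`): `per₃ ∣ (x₀₀u)³ + (x₁₀u')³`, `per₃ ∤ x₀₀u`.  Powers
  `2^j` descend through squares, so the tool matches the repeated-squaring enemy and nothing more.
* `stub_additiveCreation`: TRUE (prime walk; `perPoly_irreducible`).  `2 ≤ n` is load-bearing (`n = 1`:
  `g = x₀₀` is a leaf divisible by `per₁ = x₀₀`; no additive creation point) — not formalised (needs the
  characterisation of complexity-0 polynomials in the tree's circuit model).
* Tool (`one_le_degreeOf_of_perPoly_dvd`): a nonzero multiple of `per_n`, signed cofactor allowed, has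
  degree `≥ 1` in EVERY variable — the cheapest non-divisibility test (used for all witnesses above).

### (d) Targets (lead's stuck stubs): none registered this cycle (`stuck_stubs = []`).
### (e) Near-misses: none sorried.  Not attempted: Lean proof of `d*(n) = n+2` for general `n`
  (combinatorial bookkeeping of `τ(σ)`), `additiveCreation` at `n = 1`.

Landing copies (proposed 2026-08-16T11:37Z, `--kind proof --supports stmt-ValiantsHypothesis-15046`; ids in the
item's notes / the disprover's NOTES.md):
`Theorems/PerCofactorDegreeReduction/Negative/{KillCost, AutomaticPositivityTight, SignedCofactorThree,
TwoTowerStrict}.lean`.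
-/

noncomputable section

set_option linter.dupNamespace false

namespace Summit.ValiantsHypothesis.ValiantsHypothesis.Cruxes.PerCofactorDegreeReduction.Disproof

open Literature.Computability.AlgebraicComplexity MvPolynomial
open Summit.ValiantsHypothesis.ValiantsHypothesis.Theses.DivisionGap
  (PerCofactorDegreeReduction PerMultiplesHard)
open Summit.ValiantsHypothesis.Theorems.PerDivisionHardNegative
open scoped NNReal

/-! ## § KillCost — load-bearing `≠ 0`, uniform witness, and the price of a kill (crux, K1, K2) -/

open Summit.ValiantsHypothesis.ValiantsHypothesis.Theses.DivisionGap
  (PerCofactorDegreeReduction PerMultiplesHard)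

/-! ### Arithmetic of the quasi-polynomial bound -/

/-- `n < 2 ^ ((log₂ n + a + k) ^ k)` for `k ≥ 1`. [folklore] -/
theorem lt_two_pow_qp (n a k : ℕ) (hk : 1 ≤ k) : n < 2 ^ ((Nat.log 2 n + a + k) ^ k) := by
  have h1 : n < 2 ^ (Nat.log 2 n + 1) := Nat.lt_pow_succ_log_self (by norm_num) n
  have h2 : Nat.log 2 n + 1 ≤ (Nat.log 2 n + a + k) ^ k :=
    (by omega : Nat.log 2 n + 1 ≤ Nat.log 2 n + a + k).trans (Nat.le_self_pow (by omega) _)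
  exact h1.trans_le (Nat.pow_le_pow_right (by norm_num) h2)

/-- Monotonicity of the bound in `k`. [folklore] -/
theorem qp_mono {a k k' : ℕ} (hkk : k ≤ k') (hk' : 1 ≤ k') : (a + k) ^ k ≤ (a + k') ^ k' :=
  (Nat.pow_le_pow_left (by omega) k).trans (Nat.pow_le_pow_right (by omega) hkk)

/-- `L⁺(per_n) ≤ (n+1)!`. [folklore] -/
theorem complexity_perPoly_le_factorial_succ (n : ℕ) :
    complexity (perPoly (Fin n) ℝ≥0) ≤ (n + 1).factorial := by
  rw [Nat.factorial_succ]
  exact complexity_perPoly_le_factorial n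

/-! ### The price of a kill of the crux -/

/-- **A kill of the crux exhibits a sub-exponential monotone multiple of the permanent.**  If
`PerCofactorDegreeReduction` fails then for every `k` some nonzero `h` has
`2 ^ ((log₂ n + log₂ L⁺(per_n · h) + k) ^ k) < L⁺(per_n)` (the witness `h' = 1` must fail), i.e.
`L⁺(per_n · h) < 2^{(log₂ L⁺(per_n))^{1/k}}`. [folklore] -/
theorem two_pow_lt_complexity_perPoly_of_not_pcdr (hneg : ¬ PerCofactorDegreeReduction) (k : ℕ) :
    ∃ n, ∃ h : MvPolynomial (Fin n × Fin n) ℝ≥0, h ≠ 0 ∧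
      2 ^ ((Nat.log 2 n + Nat.log 2 (complexity (perPoly (Fin n) ℝ≥0 * h)) + k) ^ k) <
        complexity (perPoly (Fin n) ℝ≥0) := by
  by_contra hcon
  push Not at hcon
  apply hneg
  refine ⟨k, fun n h hh => ⟨1, one_ne_zero, by simp, ?_⟩⟩
  rw [mul_one]
  exact hcon n h hh

/-- … with the factorial ceiling made explicit: `2 ^ ((log₂ n + log₂ s + k) ^ k) < (n+1)!`,
`s = L⁺(per_n · h)`; so `(log₂ n + log₂ s + k)^k < log₂ (n+1)! ≤ n log₂ (n+1)`. [folklore] -/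
theorem two_pow_lt_factorial_of_not_pcdr (hneg : ¬ PerCofactorDegreeReduction) (k : ℕ) :
    ∃ n, ∃ h : MvPolynomial (Fin n × Fin n) ℝ≥0, h ≠ 0 ∧
      2 ^ ((Nat.log 2 n + Nat.log 2 (complexity (perPoly (Fin n) ℝ≥0 * h)) + k) ^ k) <
        (n + 1).factorial := by
  obtain ⟨n, h, hh, hlt⟩ := two_pow_lt_complexity_perPoly_of_not_pcdr hneg k
  exact ⟨n, h, hh, hlt.trans_le (complexity_perPoly_le_factorial_succ n)⟩

/-- **… for arbitrarily large `n`** (raise `k` past `n₀!` and use `L⁺(per_m) ≤ (m+1)!`): a kill gives,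
for every `k` and beyond every `n₀`, a nonzero multiple `per_n · h` of monotone complexity `s` with
`2 ^ ((log₂ n + log₂ s + k) ^ k) < L⁺(per_n)`. [folklore] -/
theorem two_pow_lt_complexity_perPoly_io_of_not_pcdr (hneg : ¬ PerCofactorDegreeReduction)
    (k n₀ : ℕ) :
    ∃ n ≥ n₀, ∃ h : MvPolynomial (Fin n × Fin n) ℝ≥0, h ≠ 0 ∧
      2 ^ ((Nat.log 2 n + Nat.log 2 (complexity (perPoly (Fin n) ℝ≥0 * h)) + k) ^ k) <
        complexity (perPoly (Fin n) ℝ≥0) := by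
  set k' := max k n₀.factorial with hk'
  have hk'1 : 1 ≤ k' := (Nat.succ_le_of_lt n₀.factorial_pos).trans (le_max_right _ _)
  obtain ⟨n, h, hh, hlt⟩ := two_pow_lt_complexity_perPoly_of_not_pcdr hneg k'
  have hfac := hlt.trans_le (complexity_perPoly_le_factorial_succ n)
  refine ⟨n, ?_, h, hh, (Nat.pow_le_pow_right (by norm_num) (qp_mono (le_max_left _ _) hk'1)).trans_lt hlt⟩
  by_contra hlt'
  push Not at hlt'
  have h1 : (n + 1).factorial ≤ n₀.factorial := Nat.factorial_le hlt'
  have h2 : n₀.factorial ≤ k' := le_max_right _ _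
  have h3 : k' < 2 ^ k' := Nat.lt_two_pow_self
  have h4 : 2 ^ k' ≤ 2 ^ ((Nat.log 2 n + Nat.log 2 (complexity (perPoly (Fin n) ℝ≥0 * h)) + k') ^ k') :=
    Nat.pow_le_pow_right (by norm_num)
      ((by omega : k' ≤ Nat.log 2 n + Nat.log 2 (complexity (perPoly (Fin n) ℝ≥0 * h)) + k').trans
        (Nat.le_self_pow (by omega) _))
  omega

/-! ### The same price for the open stubs K1 (`stub_creationDegree`) and K2
(`stub_cheapPositivization`) of line `Sketch` -/

/-- **A kill of K1 exhibits the same object** (test `A = per_n`): a nonzero monotone multiple `g` of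
`per_n` with `2 ^ ((log₂ n + log₂ L⁺(g) + k) ^ k) < L⁺(per_n)`, for every `k ≥ 1`. [folklore] -/
theorem two_pow_lt_complexity_perPoly_of_not_creationDegree
    (hneg : ¬ ∃ k : ℕ, ∀ (n : ℕ) (g : MvPolynomial (Fin n × Fin n) ℝ≥0), g ≠ 0 →
      perPoly (Fin n) ℝ≥0 ∣ g → ∃ A : MvPolynomial (Fin n × Fin n) ℝ≥0, A ≠ 0 ∧
        perPoly (Fin n) ℝ ∣ MvPolynomial.map NNReal.toRealHom A ∧
        A.totalDegree ≤ 2 ^ ((Nat.log 2 n + Nat.log 2 (complexity g) + k) ^ k) ∧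
        complexity A ≤ 2 ^ ((Nat.log 2 n + Nat.log 2 (complexity g) + k) ^ k))
    (k : ℕ) (hk : 1 ≤ k) :
    ∃ n, ∃ g : MvPolynomial (Fin n × Fin n) ℝ≥0, g ≠ 0 ∧ perPoly (Fin n) ℝ≥0 ∣ g ∧
      2 ^ ((Nat.log 2 n + Nat.log 2 (complexity g) + k) ^ k) < complexity (perPoly (Fin n) ℝ≥0) := by
  by_contra hcon
  push Not at hcon
  apply hneg
  refine ⟨k, fun n g hg hdvd => ⟨perPoly (Fin n) ℝ≥0, perPoly_ne_zero _ _,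
    ⟨1, by rw [map_perPoly, mul_one]⟩, ?_, hcon n g hg hdvd⟩⟩
  rw [totalDegree_perPoly_holds, Fintype.card_fin]
  exact (lt_two_pow_qp n _ k hk).le

/-- **A kill of K2 exhibits the same object** (test the positivizer `p = per_n`, which always works:
`per_n · q = A ≥ 0`): a nonzero nonnegative `A ∈ (per_n)ℝ[x]` with
`2 ^ ((log₂ n + log₂ L⁺(A) + log₂ deg A + k) ^ k) < L⁺(per_n)`, for every `k ≥ 1`.  (Such an `A` is,
after complexification, a cheap element of the ideal of the permanent: its exclusion complexity.)
[folklore] -/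
theorem two_pow_lt_complexity_perPoly_of_not_cheapPositivization
    (hneg : ¬ ∃ k : ℕ, ∀ (n : ℕ) (A : MvPolynomial (Fin n × Fin n) ℝ≥0)
      (q : MvPolynomial (Fin n × Fin n) ℝ), A ≠ 0 →
      MvPolynomial.map NNReal.toRealHom A = perPoly (Fin n) ℝ * q → (∃ m, coeff m q < 0) →
      n + 2 ≤ q.totalDegree → ∃ p : MvPolynomial (Fin n × Fin n) ℝ≥0, p ≠ 0 ∧
        (∀ m, 0 ≤ coeff m (MvPolynomial.map NNReal.toRealHom p * q)) ∧
        p.totalDegree ≤ 2 ^ ((Nat.log 2 n + Nat.log 2 (complexity A) + Nat.log 2 A.totalDegree + k) ^ k) ∧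
        complexity p ≤ 2 ^ ((Nat.log 2 n + Nat.log 2 (complexity A) + Nat.log 2 A.totalDegree + k) ^ k))
    (k : ℕ) (hk : 1 ≤ k) :
    ∃ n, ∃ A : MvPolynomial (Fin n × Fin n) ℝ≥0, A ≠ 0 ∧
      perPoly (Fin n) ℝ ∣ MvPolynomial.map NNReal.toRealHom A ∧
      2 ^ ((Nat.log 2 n + Nat.log 2 (complexity A) + Nat.log 2 A.totalDegree + k) ^ k) <
        complexity (perPoly (Fin n) ℝ≥0) := by
  by_contra hcon
  push Not at hcon
  apply hneg
  refine ⟨k, fun n A q hA hAq _ _ => ⟨perPoly (Fin n) ℝ≥0, perPoly_ne_zero _ _, fun m => ?_, ?_,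
    hcon n A hA ⟨q, hAq⟩⟩⟩
  · rw [map_perPoly, ← hAq, coeff_map]
    exact NNReal.coe_nonneg _
  · rw [totalDegree_perPoly_holds, Fintype.card_fin]
    have := lt_two_pow_qp n (Nat.log 2 (complexity A) + Nat.log 2 A.totalDegree) k hk
    rw [← add_assoc] at this
    exact this.le

/-! ### The two `≠ 0` of the crux -/

/-- **Without `h' ≠ 0` the crux is trivial** (`h' = 0`: degree `0`, `L⁺(per_n · 0) = L⁺(0) = 0`).
[folklore] -/
theorem pcdr_without_witness_nonzero :
    ∃ k : ℕ, ∀ (n : ℕ) (h : MvPolynomial (Fin n × Fin n) ℝ≥0), h ≠ 0 →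
      ∃ h' : MvPolynomial (Fin n × Fin n) ℝ≥0,
        h'.totalDegree ≤ 2 ^ ((Nat.log 2 n + Nat.log 2 (complexity (perPoly (Fin n) ℝ≥0 * h)) + k) ^ k) ∧
        complexity (perPoly (Fin n) ℝ≥0 * h') ≤
          2 ^ ((Nat.log 2 n + Nat.log 2 (complexity (perPoly (Fin n) ℝ≥0 * h)) + k) ^ k) :=
  ⟨0, fun n h _ => ⟨0, by simp, by rw [mul_zero, complexity_zero]; exact Nat.zero_le _⟩⟩

/-- **`h ≠ 0` is load-bearing modulo H1.**  With `h ≠ 0` deleted, `h = 0` makes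
`s = L⁺(per_n · 0) = 0`, and the crux then asserts for every `n` a nonzero `h'` with
`L⁺(per_n · h') ≤ 2 ^ ((log₂ n + k) ^ k)` — which contradicts `PerMultiplesHard` at `c = k`.
[folklore] -/
theorem not_perMultiplesHard_of_pcdr_without_nonzero
    (H : ∃ k : ℕ, ∀ (n : ℕ) (h : MvPolynomial (Fin n × Fin n) ℝ≥0),
      ∃ h' : MvPolynomial (Fin n × Fin n) ℝ≥0, h' ≠ 0 ∧
        h'.totalDegree ≤ 2 ^ ((Nat.log 2 n + Nat.log 2 (complexity (perPoly (Fin n) ℝ≥0 * h)) + k) ^ k) ∧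
        complexity (perPoly (Fin n) ℝ≥0 * h') ≤
          2 ^ ((Nat.log 2 n + Nat.log 2 (complexity (perPoly (Fin n) ℝ≥0 * h)) + k) ^ k)) :
    ¬ PerMultiplesHard := by
  intro hPMH
  obtain ⟨k, hk⟩ := H
  obtain ⟨n₀, hn₀⟩ := hPMH k
  obtain ⟨h', hh', -, hle⟩ := hk n₀ 0
  rw [mul_zero, complexity_zero, Nat.log_zero_right, add_zero] at hle
  exact absurd (hn₀ n₀ le_rfl h' hh') (not_lt.mpr hle)

/-! ### The witness may be chosen uniformly in `h` -/

/-- **The crux is a statement about ONE function of `n`.**  Because the bound `B` depends on `h`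
only through `s = L⁺(per_n · h)`, monotonically, and `s` attains a minimum `E_n` (the monotone
exclusion complexity of `per_n`) over `h ≠ 0`, the witness `h'` can be chosen depending on `n` alone:
PCDR `↔ ∃ k ∀ n ∃ h' ≠ 0 ∀ h ≠ 0, deg h' ≤ B(h) ∧ L⁺(per_n · h') ≤ B(h)`.  So PCDR says exactly: the
cheapest nonzero multiple of `per_n` of degree `≤ qp(n, E_n)` costs `≤ qp(n, E_n)`. [folklore] -/
theorem pcdr_iff_uniform_witness :
    PerCofactorDegreeReduction ↔ ∃ k : ℕ, ∀ n : ℕ, ∃ h' : MvPolynomial (Fin n × Fin n) ℝ≥0, h' ≠ 0 ∧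
      ∀ h : MvPolynomial (Fin n × Fin n) ℝ≥0, h ≠ 0 →
        h'.totalDegree ≤ 2 ^ ((Nat.log 2 n +
          Nat.log 2 (complexity (perPoly (Fin n) ℝ≥0 * h)) + k) ^ k) ∧
        complexity (perPoly (Fin n) ℝ≥0 * h') ≤ 2 ^ ((Nat.log 2 n +
          Nat.log 2 (complexity (perPoly (Fin n) ℝ≥0 * h)) + k) ^ k) := by
  classical
  constructor
  · rintro ⟨k, hk⟩
    refine ⟨k, fun n => ?_⟩
    -- a multiplier of minimal monotone cost
    let P : ℕ → Prop := fun s => ∃ h : MvPolynomial (Fin n × Fin n) ℝ≥0, h ≠ 0 ∧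
      complexity (perPoly (Fin n) ℝ≥0 * h) = s
    have hP : ∃ s, P s := ⟨_, 1, one_ne_zero, rfl⟩
    obtain ⟨h₀, hh₀, hs₀⟩ := Nat.find_spec hP
    have hmin : ∀ h : MvPolynomial (Fin n × Fin n) ℝ≥0, h ≠ 0 →
        complexity (perPoly (Fin n) ℝ≥0 * h₀) ≤ complexity (perPoly (Fin n) ℝ≥0 * h) := by
      intro h hh
      rw [hs₀]
      exact Nat.find_min' hP ⟨h, hh, rfl⟩
    obtain ⟨h', hh', hdeg, hcost⟩ := hk n h₀ hh₀
    refine ⟨h', hh', fun h hh => ?_⟩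
    have hB : 2 ^ ((Nat.log 2 n + Nat.log 2 (complexity (perPoly (Fin n) ℝ≥0 * h₀)) + k) ^ k) ≤
        2 ^ ((Nat.log 2 n + Nat.log 2 (complexity (perPoly (Fin n) ℝ≥0 * h)) + k) ^ k) :=
      Nat.pow_le_pow_right (by norm_num) (Nat.pow_le_pow_left
        (by have := Nat.log_mono_right (b := 2) (hmin h hh); omega) k)
    exact ⟨hdeg.trans hB, hcost.trans hB⟩
  · rintro ⟨k, hk⟩
    refine ⟨k, fun n h hh => ?_⟩
    obtain ⟨h', hh', hall⟩ := hk n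
    exact ⟨h', hh', hall h hh⟩

/-! ## § AutomaticPositivityTight — the window `n + 1` of `stub_automaticPositivity` is sharp (n = 2); no Pólya shortcut -/

/-- `a = x₀₀ x₁₁`, the diagonal monomial of `per₂`. [folklore] -/
def pa : MvPolynomial (Fin 2 × Fin 2) ℝ := X ((0 : Fin 2), (0 : Fin 2)) * X ((1 : Fin 2), (1 : Fin 2))

/-- `b = x₁₀ x₀₁`, the anti-diagonal monomial of `per₂`. [folklore] -/
def pb : MvPolynomial (Fin 2 × Fin 2) ℝ := X ((1 : Fin 2), (0 : Fin 2)) * X ((0 : Fin 2), (1 : Fin 2))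

/-- The signed cofactor `q = a² − ab + b²` (degree `4 = n + 2`). [folklore] -/
def q2 : MvPolynomial (Fin 2 × Fin 2) ℝ := pa * pa - pa * pb + pb * pb

/-- `per₂ = a + b` (tree: `permanent_fin_two`). [folklore] -/
theorem perPoly_two_eq : perPoly (Fin 2) ℝ = pa + pb := by
  rw [perPoly, permanent_fin_two, pa, pb]
  simp [Matrix.mvPolynomialX_apply]

/-- `per₂ · q = a³ + b³`. [folklore] -/
theorem perPoly_two_mul_q2 : perPoly (Fin 2) ℝ * q2 = pa ^ 3 + pb ^ 3 := by
  rw [perPoly_two_eq, q2]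
  ring

/-- `a³` is a monomial with coefficient `1`. [folklore] -/
theorem pa_pow_three : pa ^ 3 =
    monomial (Finsupp.single ((0 : Fin 2), (0 : Fin 2)) 3 + Finsupp.single ((1 : Fin 2), (1 : Fin 2)) 3) 1 := by
  rw [pa, mul_pow, X_pow_eq_monomial, X_pow_eq_monomial, monomial_mul, mul_one]

/-- `b³` is a monomial with coefficient `1`. [folklore] -/
theorem pb_pow_three : pb ^ 3 =
    monomial (Finsupp.single ((1 : Fin 2), (0 : Fin 2)) 3 + Finsupp.single ((0 : Fin 2), (1 : Fin 2)) 3) 1 := by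
  rw [pb, mul_pow, X_pow_eq_monomial, X_pow_eq_monomial, monomial_mul, mul_one]

/-- `per₂ · q ≥ 0` coefficientwise. [folklore] -/
theorem coeff_perPoly_two_mul_q2_nonneg (m : (Fin 2 × Fin 2) →₀ ℕ) :
    0 ≤ coeff m (perPoly (Fin 2) ℝ * q2) := by
  rw [perPoly_two_mul_q2, coeff_add, pa_pow_three, pb_pow_three, coeff_monomial, coeff_monomial]
  split_ifs <;> norm_num

/-- `deg q ≤ 4`. [folklore] -/
theorem totalDegree_q2_le : q2.totalDegree ≤ 2 + 2 := by
  have ha : pa.totalDegree ≤ 2 := by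
    refine (totalDegree_mul _ _).trans ?_
    rw [totalDegree_X, totalDegree_X]
  have hb : pb.totalDegree ≤ 2 := by
    refine (totalDegree_mul _ _).trans ?_
    rw [totalDegree_X, totalDegree_X]
  have haa : (pa * pa).totalDegree ≤ 4 := (totalDegree_mul _ _).trans (by omega)
  have hab : (pa * pb).totalDegree ≤ 4 := (totalDegree_mul _ _).trans (by omega)
  have hbb : (pb * pb).totalDegree ≤ 4 := (totalDegree_mul _ _).trans (by omega)
  have h1 : (pa * pa - pa * pb).totalDegree ≤ 4 :=
    (totalDegree_sub _ _).trans (max_le haa hab)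
  exact (totalDegree_add _ _).trans (max_le h1 hbb)

/-- The exponent of `ab = x₀₀ x₁₁ x₁₀ x₀₁`. [folklore] -/
def mab : (Fin 2 × Fin 2) →₀ ℕ :=
  Finsupp.single ((0 : Fin 2), (0 : Fin 2)) 1 + Finsupp.single ((1 : Fin 2), (1 : Fin 2)) 1 +
    (Finsupp.single ((1 : Fin 2), (0 : Fin 2)) 1 + Finsupp.single ((0 : Fin 2), (1 : Fin 2)) 1)

/-- `ab` is the monomial with exponent `mab`. [folklore] -/
theorem pa_mul_pb : pa * pb = monomial mab 1 := by
  rw [pa, pb, X, X, X, X, monomial_mul, monomial_mul, monomial_mul, mab]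
  norm_num

/-- `a²` as a monomial. [folklore] -/
theorem pa_mul_pa : pa * pa = monomial
    (Finsupp.single ((0 : Fin 2), (0 : Fin 2)) 1 + Finsupp.single ((1 : Fin 2), (1 : Fin 2)) 1 +
      (Finsupp.single ((0 : Fin 2), (0 : Fin 2)) 1 + Finsupp.single ((1 : Fin 2), (1 : Fin 2)) 1)) 1 := by
  rw [pa, X, X, monomial_mul, monomial_mul]
  norm_num

/-- `b²` as a monomial. [folklore] -/
theorem pb_mul_pb : pb * pb = monomial
    (Finsupp.single ((1 : Fin 2), (0 : Fin 2)) 1 + Finsupp.single ((0 : Fin 2), (1 : Fin 2)) 1 +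
      (Finsupp.single ((1 : Fin 2), (0 : Fin 2)) 1 + Finsupp.single ((0 : Fin 2), (1 : Fin 2)) 1)) 1 := by
  rw [pb, X, X, monomial_mul, monomial_mul]
  norm_num

/-- The exponents of `a²` and `ab` differ. [folklore] -/
theorem aa_ne_mab :
    (Finsupp.single ((0 : Fin 2), (0 : Fin 2)) 1 + Finsupp.single ((1 : Fin 2), (1 : Fin 2)) 1 +
      (Finsupp.single ((0 : Fin 2), (0 : Fin 2)) 1 + Finsupp.single ((1 : Fin 2), (1 : Fin 2)) 1) :
      (Fin 2 × Fin 2) →₀ ℕ) ≠ mab := by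
  rw [mab, Ne, ← DFunLike.coe_fn_eq]
  simp only [Finsupp.coe_add, Finsupp.single_eq_pi_single]
  decide

/-- The exponents of `b²` and `ab` differ. [folklore] -/
theorem bb_ne_mab :
    (Finsupp.single ((1 : Fin 2), (0 : Fin 2)) 1 + Finsupp.single ((0 : Fin 2), (1 : Fin 2)) 1 +
      (Finsupp.single ((1 : Fin 2), (0 : Fin 2)) 1 + Finsupp.single ((0 : Fin 2), (1 : Fin 2)) 1) :
      (Fin 2 × Fin 2) →₀ ℕ) ≠ mab := by
  rw [mab, Ne, ← DFunLike.coe_fn_eq]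
  simp only [Finsupp.coe_add, Finsupp.single_eq_pi_single]
  decide

/-- The coefficient of `ab` in `q` is `−1`. [folklore] -/
theorem coeff_mab_q2 : coeff mab q2 = -1 := by
  rw [q2, coeff_add, coeff_sub, pa_mul_pb, pa_mul_pa, pb_mul_pb, coeff_monomial, coeff_monomial,
    coeff_monomial, if_neg aa_ne_mab, if_pos rfl, if_neg bb_ne_mab]
  norm_num

/-- **The window `n + 1` of `stub_automaticPositivity` is sharp**: widened to `n + 2` the statement
fails at `n = 2`, `q = a² − ab + b²` (`per₂ · q = a³ + b³ ≥ 0`, `coeff_{ab} q = −1`).  Hence signed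
cofactors of nonnegative multiples of `per_n` exist from degree `n + 2` on, and the hypothesis
`n + 2 ≤ q.totalDegree` of K2 (`stub_cheapPositivization`) starts exactly at the first signed degree.
[folklore] -/
theorem not_automaticPositivity_add_two :
    ¬ ∀ (n : ℕ) (q : MvPolynomial (Fin n × Fin n) ℝ), q.totalDegree ≤ n + 2 →
        (∀ m, 0 ≤ coeff m (perPoly (Fin n) ℝ * q)) → ∀ m, 0 ≤ coeff m q := by
  intro H
  have h := H 2 q2 totalDegree_q2_le coeff_perPoly_two_mul_q2_nonneg mab
  rw [coeff_mab_q2] at h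
  norm_num at h

/-- The same witness, packaged positively: a signed cofactor of degree `n + 2` at `n = 2`. [folklore] -/
theorem exists_signed_cofactor_degree_add_two :
    ∃ q : MvPolynomial (Fin 2 × Fin 2) ℝ, q.totalDegree ≤ 2 + 2 ∧
      (∀ m, 0 ≤ coeff m (perPoly (Fin 2) ℝ * q)) ∧ ∃ m, coeff m q < 0 :=
  ⟨q2, totalDegree_q2_le, coeff_perPoly_two_mul_q2_nonneg, mab, by rw [coeff_mab_q2]; norm_num⟩

/-! ### No Pólya shortcut: the universal multiplier `(Σ x)^N` never positivizes `q` -/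

/-- The sum of the three variables other than `x₀₀`. [folklore] -/
def rest : MvPolynomial (Fin 2 × Fin 2) ℝ :=
  X ((0 : Fin 2), (1 : Fin 2)) + (X ((1 : Fin 2), (0 : Fin 2)) + X ((1 : Fin 2), (1 : Fin 2)))

/-- The sum of all four variables, `Σ_v x_v = x₀₀ + rest`. [folklore] -/
def sx : MvPolynomial (Fin 2 × Fin 2) ℝ := X ((0 : Fin 2), (0 : Fin 2)) + rest

/-- `Σ_v x_v` is literally the sum over all cells. [folklore] -/
theorem sx_eq_sum : sx = ∑ v : Fin 2 × Fin 2, X v := by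
  rw [Fintype.sum_prod_type, Fin.sum_univ_two, Fin.sum_univ_two, Fin.sum_univ_two, sx, rest]
  ring

/-- `rest` does not involve `x₀₀`. [folklore] -/
theorem degreeOf_rest : degreeOf ((0 : Fin 2), (0 : Fin 2)) rest = 0 := by
  have hX : ∀ w : Fin 2 × Fin 2, ((0 : Fin 2), (0 : Fin 2)) ≠ w →
      degreeOf ((0 : Fin 2), (0 : Fin 2)) (X w : MvPolynomial (Fin 2 × Fin 2) ℝ) = 0 := fun w h => by
    rw [degreeOf_X, if_neg h]
  have hadd : ∀ f g : MvPolynomial (Fin 2 × Fin 2) ℝ, degreeOf ((0 : Fin 2), (0 : Fin 2)) f = 0 →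
      degreeOf ((0 : Fin 2), (0 : Fin 2)) g = 0 → degreeOf ((0 : Fin 2), (0 : Fin 2)) (f + g) = 0 :=
    fun f g hf hg => Nat.le_zero.mp ((degreeOf_add_le _ f g).trans (by rw [hf, hg, max_self]))
  exact hadd _ _ (hX _ (by decide)) (hadd _ _ (hX _ (by decide)) (hX _ (by decide)))

/-- A power of `rest` has no monomial with a positive `x₀₀`-exponent. [folklore] -/
theorem coeff_rest_pow_eq_zero {m : (Fin 2 × Fin 2) →₀ ℕ} (hm : 0 < m ((0 : Fin 2), (0 : Fin 2)))
    (j : ℕ) : coeff m (rest ^ j) = 0 := by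
  rw [← notMem_support_iff]
  intro hmem
  have h1 := monomial_le_degreeOf ((0 : Fin 2), (0 : Fin 2)) hmem
  have h2 : degreeOf ((0 : Fin 2), (0 : Fin 2)) (rest ^ j) = 0 :=
    Nat.le_zero.mp ((degreeOf_pow_le _ _ j).trans (by rw [degreeOf_rest, mul_zero]))
  omega

/-- **`coeff_{x₀₀^N} (Σ_v x_v)^N = 1`.** [folklore] -/
theorem coeff_sx_pow (N : ℕ) : coeff (Finsupp.single ((0 : Fin 2), (0 : Fin 2)) N) (sx ^ N) = 1 := by
  rw [sx, add_pow, coeff_sum, Finset.sum_eq_single_of_mem N (Finset.mem_range.mpr (Nat.lt_succ_self N))]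
  · rw [Nat.sub_self, pow_zero, mul_one, Nat.choose_self, Nat.cast_one, mul_one, X_pow_eq_monomial,
      coeff_monomial, if_pos rfl]
  · intro k hk hkN
    have hk' : k < N := lt_of_le_of_ne (Nat.lt_succ_iff.mp (Finset.mem_range.mp hk)) hkN
    rw [X_pow_eq_monomial, mul_assoc, coeff_monomial_mul']
    split_ifs with hle
    · rw [mul_comm (rest ^ (N - k)), ← map_natCast (C : ℝ →+* MvPolynomial (Fin 2 × Fin 2) ℝ),
        coeff_C_mul, coeff_rest_pow_eq_zero, mul_zero, mul_zero]
      simp only [Finsupp.tsub_apply, Finsupp.single_eq_same]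
      omega
    · rfl

/-- The exponent `x₀₀^N · x₀₀x₁₁x₁₀x₀₁`. [folklore] -/
def eT (N : ℕ) : (Fin 2 × Fin 2) →₀ ℕ := Finsupp.single ((0 : Fin 2), (0 : Fin 2)) N + mab

/-- **`coeff_{x₀₀^{N+1}x₁₁x₁₀x₀₁} ((Σ_v x_v)^N · q) = −1` for every `N`.**  The monomial
`x₀₀^{N+1}x₁₁x₁₀x₀₁` is reached only through `x₀₀^N · (−ab)`: the squares `a²`, `b²` carry `x₁₁²`,
`x₁₀²`. [folklore] -/
theorem coeff_eT_sx_pow_mul_q2 (N : ℕ) : coeff (eT N) (sx ^ N * q2) = -1 := by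
  have hAA : ¬ (Finsupp.single ((0 : Fin 2), (0 : Fin 2)) 1 + Finsupp.single ((1 : Fin 2), (1 : Fin 2)) 1 +
      (Finsupp.single ((0 : Fin 2), (0 : Fin 2)) 1 + Finsupp.single ((1 : Fin 2), (1 : Fin 2)) 1) :
      (Fin 2 × Fin 2) →₀ ℕ) ≤ eT N := fun h => by
    have := Finsupp.le_def.mp h ((1 : Fin 2), (1 : Fin 2))
    simp [eT, mab] at this
  have hBB : ¬ (Finsupp.single ((1 : Fin 2), (0 : Fin 2)) 1 + Finsupp.single ((0 : Fin 2), (1 : Fin 2)) 1 +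
      (Finsupp.single ((1 : Fin 2), (0 : Fin 2)) 1 + Finsupp.single ((0 : Fin 2), (1 : Fin 2)) 1) :
      (Fin 2 × Fin 2) →₀ ℕ) ≤ eT N := fun h => by
    have := Finsupp.le_def.mp h ((1 : Fin 2), (0 : Fin 2))
    simp [eT, mab] at this
  have hAB : mab ≤ eT N := by rw [eT]; exact le_add_self
  rw [q2, mul_add, mul_sub, coeff_add, coeff_sub, pa_mul_pa, pa_mul_pb, pb_mul_pb,
    coeff_mul_monomial', coeff_mul_monomial', coeff_mul_monomial', if_neg hAA, if_neg hBB,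
    if_pos hAB, eT, add_tsub_cancel_right, coeff_sx_pow]
  norm_num

/-- **No Pólya shortcut for K2.**  The universal cheap multiplier `(Σ_v x_v)^N` (Pólya's theorem
positivizes forms that are STRICTLY positive on the simplex) never positivizes the signed cofactor
`q = a² − ab + b²` of `per₂`: `q` vanishes at the vertex `x₀₀ = 1` of the simplex, and the
coefficient of `x₀₀^{N+1}x₁₁x₁₀x₀₁` in `(Σ_v x_v)^N · q` is `−1` for every `N`.  (By contrast
`per₂ · q = a³ + b³ ≥ 0`.)  Positivizers for `stub_cheapPositivization` must be adapted to `q`.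
[folklore] -/
theorem not_polya_positivizer :
    ¬ ∃ N : ℕ, ∀ m, 0 ≤ coeff m ((∑ v : Fin 2 × Fin 2, X v) ^ N * q2) := by
  rintro ⟨N, hN⟩
  have h := hN (eT N)
  rw [← sx_eq_sum, coeff_eT_sx_pow_mul_q2] at h
  norm_num at h

/-! ## § SignedCofactorThree — the same at `n = 3` by the general mechanism -/

namespace Three


section Defs

variable (R : Type*) [CommSemiring R]

/-- Shorthand for the variable `x_{ij}`, `i j : Fin 3`. -/
abbrev x (i j : Fin 3) : MvPolynomial (Fin 3 × Fin 3) R := X (i, j)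

/-- The six permutation monomials of `per₃` (cells `(row, col)`): `id`. [folklore] -/
def pid : MvPolynomial (Fin 3 × Fin 3) R := x R 0 0 * x R 1 1 * x R 2 2
/-- Permutation monomial `a = (0,0)(2,1)(1,2)`. [folklore] -/
def pa : MvPolynomial (Fin 3 × Fin 3) R := x R 0 0 * x R 2 1 * x R 1 2
/-- Permutation monomial `b = (1,0)(0,1)(2,2)`. [folklore] -/
def pb : MvPolynomial (Fin 3 × Fin 3) R := x R 1 0 * x R 0 1 * x R 2 2
/-- Permutation monomial `c = (1,0)(2,1)(0,2)`. [folklore] -/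
def pc : MvPolynomial (Fin 3 × Fin 3) R := x R 1 0 * x R 2 1 * x R 0 2
/-- Permutation monomial `d = (2,0)(0,1)(1,2)`. [folklore] -/
def pd : MvPolynomial (Fin 3 × Fin 3) R := x R 2 0 * x R 0 1 * x R 1 2
/-- Permutation monomial `e = (2,0)(1,1)(0,2)`. [folklore] -/
def pe : MvPolynomial (Fin 3 × Fin 3) R := x R 2 0 * x R 1 1 * x R 0 2

/-- `per₃` is the sum of its six permutation monomials (tree: `permanent_fin_three`). [folklore] -/
theorem perPoly_three_eq : perPoly (Fin 3) R = pid R + pa R + pb R + pc R + pd R + pe R := by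
  rw [perPoly, permanent_fin_three, pid, pa, pb, pc, pd, pe]
  simp only [Matrix.mvPolynomialX_apply]
  ring

/-- `R_id = per₃ − x^{id}` written positively. [folklore] -/
def Rid : MvPolynomial (Fin 3 × Fin 3) R := pa R + pb R + pc R + pd R + pe R

/-- `R_a = per₃ − x^{a}` written positively. [folklore] -/
def Ra : MvPolynomial (Fin 3 × Fin 3) R := pid R + pb R + pc R + pd R + pe R

/-- The positive part `Σ_σ M_σ = x₁₂x₂₁ · R_id + x₀₀x₁₁²x₂₂²` of the signed cofactor. [folklore] -/
def Mpos : MvPolynomial (Fin 3 × Fin 3) R :=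
  x R 1 2 * x R 2 1 * Rid R + x R 0 0 * x R 1 1 * x R 1 1 * x R 2 2 * x R 2 2

/-- The negative monomial `x^m = x₀₀x₁₁x₁₂x₂₁x₂₂`. [folklore] -/
def xm : MvPolynomial (Fin 3 × Fin 3) R := x R 0 0 * x R 1 1 * x R 1 2 * x R 2 1 * x R 2 2

/-- The manifestly nonnegative product `G = x₀₀x₁₁²x₂₂² · R_a + x₁₂x₂₁ · R_id²`. [folklore] -/
def G : MvPolynomial (Fin 3 × Fin 3) R :=
  x R 0 0 * x R 1 1 * x R 1 1 * x R 2 2 * x R 2 2 * Ra R + x R 1 2 * x R 2 1 * Rid R * Rid R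

/-- **The positive identity** `per₃ · Σ_σ M_σ = G + per₃ · x^m` (subtraction-free form of
`per₃ · (Σ_σ M_σ − x^m) = Σ_σ M_σ (per₃ − x^{τ(σ)})`). [folklore] -/
theorem perPoly_three_mul_Mpos : perPoly (Fin 3) R * Mpos R = G R + perPoly (Fin 3) R * xm R := by
  rw [perPoly_three_eq]
  unfold Mpos G xm Rid Ra pid pa pb pc pd pe
  ring

end Defs

/-- The signed cofactor `q3 = Σ_σ M_σ − x^m` over `ℝ` (degree `5 = n + 2`). [folklore] -/
def q3 : MvPolynomial (Fin 3 × Fin 3) ℝ := Mpos ℝ - xm ℝ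

/-- `per₃ · q3 = G` over `ℝ`. [folklore] -/
theorem perPoly_three_mul_q3 : perPoly (Fin 3) ℝ * q3 = G ℝ := by
  rw [q3, mul_sub, perPoly_three_mul_Mpos]
  ring

/-- `G` over `ℝ` is the image of `G` over `ℝ≥0`. [folklore] -/
theorem map_G : MvPolynomial.map NNReal.toRealHom (G ℝ≥0) = G ℝ := by
  simp [G, Ra, Rid, pid, pa, pb, pc, pd, pe, map_X]

/-- `per₃ · q3 ≥ 0` coefficientwise. [folklore] -/
theorem coeff_perPoly_three_mul_q3_nonneg (w : (Fin 3 × Fin 3) →₀ ℕ) :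
    0 ≤ coeff w (perPoly (Fin 3) ℝ * q3) := by
  rw [perPoly_three_mul_q3, ← map_G, coeff_map]
  exact NNReal.coe_nonneg _

/-- `q3` is a quintic form, so `deg q3 ≤ 5`. [folklore] -/
theorem totalDegree_q3_le : q3.totalDegree ≤ 3 + 2 := by
  have hX : ∀ i j : Fin 3, (x ℝ i j).IsHomogeneous 1 := fun i j => isHomogeneous_X ℝ _
  have h3 : ∀ p ∈ [pa ℝ, pb ℝ, pc ℝ, pd ℝ, pe ℝ], p.IsHomogeneous 3 := by
    intro p hp
    simp only [List.mem_cons, List.not_mem_nil, or_false] at hp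
    rcases hp with rfl | rfl | rfl | rfl | rfl <;>
      exact ((hX _ _).mul (hX _ _)).mul (hX _ _)
  have hRid : (Rid ℝ).IsHomogeneous 3 :=
    ((((h3 _ (by simp)).add (h3 _ (by simp))).add (h3 _ (by simp))).add (h3 _ (by simp))).add
      (h3 _ (by simp))
  have hM : (Mpos ℝ).IsHomogeneous 5 :=
    (((hX _ _).mul (hX _ _)).mul hRid).add (((((hX _ _).mul (hX _ _)).mul (hX _ _)).mul (hX _ _)).mul
      (hX _ _))
  have hm : (xm ℝ).IsHomogeneous 5 := ((((hX _ _).mul (hX _ _)).mul (hX _ _)).mul (hX _ _)).mul (hX _ _)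
  exact (hM.sub hm).totalDegree_le

/-- The exponent of `x^m = x₀₀x₁₁x₁₂x₂₁x₂₂` (in the product order of `xm`). [folklore] -/
def em : (Fin 3 × Fin 3) →₀ ℕ :=
  Finsupp.single ((0 : Fin 3), (0 : Fin 3)) 1 + Finsupp.single ((1 : Fin 3), (1 : Fin 3)) 1 +
    Finsupp.single ((1 : Fin 3), (2 : Fin 3)) 1 + Finsupp.single ((2 : Fin 3), (1 : Fin 3)) 1 +
    Finsupp.single ((2 : Fin 3), (2 : Fin 3)) 1

/-- `x^m` as a monomial. [folklore] -/
theorem xm_eq : xm ℝ = monomial em 1 := by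
  unfold xm x em
  simp only [X, monomial_mul, mul_one]

/-- The coefficient of `x^m` in the positive part vanishes (each of its six monomials differs from
`x^m`: it carries `x₁₂²`, `x₀₁`, `x₀₂`, `x₂₀`, `x₂₀`, `x₁₁²` respectively). [folklore] -/
theorem coeff_em_Mpos : coeff em (Mpos ℝ) = 0 := by
  unfold Mpos Rid pa pb pc pd pe x
  simp only [X, monomial_mul, mul_add, coeff_add, coeff_monomial, mul_one]
  have key : ∀ s : (Fin 3 × Fin 3) →₀ ℕ, (⇑s ≠ ⇑em) → (if s = em then (1 : ℝ) else 0) = 0 :=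
    fun s hs => if_neg fun h => hs (by rw [h])
  rw [key, key, key, key, key, key]
  · norm_num
  all_goals
    simp only [em, Finsupp.coe_add, Finsupp.single_eq_pi_single]
    decide

/-- **The coefficient of `x^m` in `q3` is `−1`.** [folklore] -/
theorem coeff_q3_neg : coeff em q3 = -1 := by
  rw [q3, coeff_sub, coeff_em_Mpos, xm_eq, coeff_monomial, if_pos rfl]
  norm_num

/-- **A signed cofactor of degree `n + 2` at `n = 3`**: `deg q3 ≤ 5`, `per₃ · q3 ≥ 0`,
`coeff_{x^m} q3 = −1`.  With `Negative/AutomaticPositivityTight.lean` (`n = 2`): the window `n + 1`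
of `stub_automaticPositivity` is attained-plus-one at `n = 2` and `n = 3` by the same mechanism.
[folklore] -/
theorem exists_signed_cofactor_three :
    ∃ q : MvPolynomial (Fin 3 × Fin 3) ℝ, q.totalDegree ≤ 3 + 2 ∧
      (∀ w, 0 ≤ coeff w (perPoly (Fin 3) ℝ * q)) ∧ ∃ w, coeff w q < 0 :=
  ⟨q3, totalDegree_q3_le, coeff_perPoly_three_mul_q3_nonneg, em, by rw [coeff_q3_neg]; norm_num⟩

/-- The same, as a refutation of the widened window at `n = 3` specifically. [folklore] -/
theorem not_automaticPositivity_add_two_at_three :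
    ¬ ∀ (q : MvPolynomial (Fin 3 × Fin 3) ℝ), q.totalDegree ≤ 3 + 2 →
        (∀ w, 0 ≤ coeff w (perPoly (Fin 3) ℝ * q)) → ∀ w, 0 ≤ coeff w q := by
  intro H
  have h := H q3 totalDegree_q3_le coeff_perPoly_three_mul_q3_nonneg em
  rw [coeff_q3_neg] at h
  norm_num at h

end Three

/-! ## § TwoTowerStrict — `deg V < N` is load-bearing in `stub_twoTowerCollapse`; no cube descent -/

/-! ### The tool: multiples of the permanent use every variable -/

section Tool

variable {ι : Type*} [Fintype ι] [DecidableEq ι] {k : Type*} [CommRing k] [IsDomain k]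

/-- **A nonzero multiple of `per` involves every variable**: if `per ∣ f ≠ 0` then
`degreeOf v f ≥ 1` for all cells `v` (the permanent has degree exactly `1` in every variable and
`degreeOf` is additive over a domain). [folklore] -/
theorem one_le_degreeOf_of_perPoly_dvd {f : MvPolynomial (ι × ι) k} (hdvd : perPoly ι k ∣ f)
    (hf : f ≠ 0) (v : ι × ι) : 1 ≤ degreeOf v f := by
  obtain ⟨w, rfl⟩ := hdvd
  have hw : w ≠ 0 := by
    rintro rfl
    exact hf (mul_zero _)
  rw [degreeOf_mul_eq (perPoly_ne_zero ι k) hw, degreeOf_perPoly k v]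
  omega

/-- Contrapositive form: a nonzero polynomial missing a variable is not a multiple of `per`. [folklore] -/
theorem not_perPoly_dvd_of_degreeOf_eq_zero {f : MvPolynomial (ι × ι) k} (hf : f ≠ 0) (v : ι × ι)
    (hv : degreeOf v f = 0) : ¬ perPoly ι k ∣ f := fun hdvd => by
  have := one_le_degreeOf_of_perPoly_dvd hdvd hf v
  omega

end Tool

/-! ### A small `degreeOf = 0` calculus -/

section DegreeOfZero

variable {σ : Type*} {R : Type*} [CommSemiring R] (v : σ)

/-- [folklore] -/
theorem degreeOf_add_eq_zero {f g : MvPolynomial σ R} (hf : degreeOf v f = 0) (hg : degreeOf v g = 0) :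
    degreeOf v (f + g) = 0 :=
  Nat.le_zero.mp ((degreeOf_add_le v f g).trans (by rw [hf, hg, max_self]))

/-- [folklore] -/
theorem degreeOf_mul_eq_zero {f g : MvPolynomial σ R} (hf : degreeOf v f = 0) (hg : degreeOf v g = 0) :
    degreeOf v (f * g) = 0 :=
  Nat.le_zero.mp ((degreeOf_mul_le v f g).trans (by rw [hf, hg]))

/-- [folklore] -/
theorem degreeOf_pow_eq_zero {f : MvPolynomial σ R} (hf : degreeOf v f = 0) (m : ℕ) :
    degreeOf v (f ^ m) = 0 :=
  Nat.le_zero.mp ((degreeOf_pow_le v f m).trans (by rw [hf, mul_zero]))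

/-- [folklore] -/
theorem degreeOf_X_of_ne [DecidableEq σ] [Nontrivial R] {w : σ} (h : v ≠ w) :
    degreeOf v (X w : MvPolynomial σ R) = 0 := by
  rw [degreeOf_X, if_neg h]

/-- [folklore] -/
theorem degreeOf_C_mul_eq_zero {f : MvPolynomial σ R} (a : R) (hf : degreeOf v f = 0) :
    degreeOf v (C a * f) = 0 :=
  Nat.le_zero.mp ((degreeOf_C_mul_le f v a).trans hf.le)

end DegreeOfZero

/-! ### The witnesses at `n = 3` (column-`0` Laplace expansion) -/

section Witness

variable (R : Type*) [CommSemiring R]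

/-- Shorthand for the variable `x_{ij}`, `i j : Fin 3`. -/
abbrev x (i j : Fin 3) : MvPolynomial (Fin 3 × Fin 3) R := X (i, j)

/-- The permanental minor of cell `(0,0)`: `x₁₁x₂₂ + x₂₁x₁₂`. [folklore] -/
def P00 : MvPolynomial (Fin 3 × Fin 3) R := x R 1 1 * x R 2 2 + x R 2 1 * x R 1 2

/-- The permanental minor of cell `(1,0)`: `x₀₁x₂₂ + x₂₁x₀₂`. [folklore] -/
def P10 : MvPolynomial (Fin 3 × Fin 3) R := x R 0 1 * x R 2 2 + x R 2 1 * x R 0 2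

/-- The permanental minor of cell `(2,0)`: `x₀₁x₁₂ + x₁₁x₀₂`. [folklore] -/
def P20 : MvPolynomial (Fin 3 × Fin 3) R := x R 0 1 * x R 1 2 + x R 1 1 * x R 0 2

/-- Laplace expansion of `per₃` along column `0` (tree: `permanent_fin_three`). [folklore] -/
theorem perPoly_three_eq :
    perPoly (Fin 3) R = x R 0 0 * P00 R + x R 1 0 * P10 R + x R 2 0 * P20 R := by
  rw [perPoly, permanent_fin_three, P00, P10, P20]
  simp [Matrix.mvPolynomialX_apply]

/-- The first tower base `u = x₀₀ P₀₀ + x₂₀ P₂₀` (the part of `per₃` off the cell `(1,0)`). [folklore] -/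
def tu : MvPolynomial (Fin 3 × Fin 3) R := x R 0 0 * P00 R + x R 2 0 * P20 R

/-- The second tower base `u' = x₀₀ P₁₀`. [folklore] -/
def tu' : MvPolynomial (Fin 3 × Fin 3) R := x R 0 0 * P10 R

/-- **The positive two-term relation** `x₀₀ · u + x₁₀ · u' = x₀₀ · per₃`. [folklore] -/
theorem key_relation : x R 0 0 * tu R + x R 1 0 * tu' R = x R 0 0 * perPoly (Fin 3) R := by
  rw [perPoly_three_eq, tu, tu']
  ring

variable {R}

/-- Base change of the witnesses along a semiring map. [folklore] -/
theorem map_tu {S : Type*} [CommSemiring S] (φ : R →+* S) : map φ (tu R) = tu S := by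
  simp [tu, P00, P20, map_X]

/-- Base change of the witnesses along a semiring map. [folklore] -/
theorem map_tu' {S : Type*} [CommSemiring S] (φ : R →+* S) : map φ (tu' R) = tu' S := by
  simp [tu', P10, map_X]

end Witness

/-! ### Non-divisibility of the witnesses over `ℝ` -/

section Real

/-- `u` misses the variable `x₁₀`. [folklore] -/
theorem degreeOf_tu : degreeOf ((1 : Fin 3), (0 : Fin 3)) (tu ℝ) = 0 := by
  unfold tu P00 P20 x
  refine degreeOf_add_eq_zero _ (degreeOf_mul_eq_zero _ (degreeOf_X_of_ne _ (by decide))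
    (degreeOf_add_eq_zero _ (degreeOf_mul_eq_zero _ (degreeOf_X_of_ne _ (by decide))
      (degreeOf_X_of_ne _ (by decide))) (degreeOf_mul_eq_zero _ (degreeOf_X_of_ne _ (by decide))
      (degreeOf_X_of_ne _ (by decide)))))
    (degreeOf_mul_eq_zero _ (degreeOf_X_of_ne _ (by decide))
    (degreeOf_add_eq_zero _ (degreeOf_mul_eq_zero _ (degreeOf_X_of_ne _ (by decide))
      (degreeOf_X_of_ne _ (by decide))) (degreeOf_mul_eq_zero _ (degreeOf_X_of_ne _ (by decide))
      (degreeOf_X_of_ne _ (by decide)))))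

/-- `u'` misses the variable `x₁₀`. [folklore] -/
theorem degreeOf_tu' : degreeOf ((1 : Fin 3), (0 : Fin 3)) (tu' ℝ) = 0 := by
  unfold tu' P10 x
  exact degreeOf_mul_eq_zero _ (degreeOf_X_of_ne _ (by decide))
    (degreeOf_add_eq_zero _ (degreeOf_mul_eq_zero _ (degreeOf_X_of_ne _ (by decide))
      (degreeOf_X_of_ne _ (by decide))) (degreeOf_mul_eq_zero _ (degreeOf_X_of_ne _ (by decide))
      (degreeOf_X_of_ne _ (by decide))))

/-- `u(1,…,1) = 4`. [folklore] -/
theorem eval_one_tu : eval (fun _ => (1 : ℝ)) (tu ℝ) = 4 := by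
  simp [tu, P00, P20]
  norm_num

/-- `u'(1,…,1) = 2`. [folklore] -/
theorem eval_one_tu' : eval (fun _ => (1 : ℝ)) (tu' ℝ) = 2 := by
  simp [tu', P10]
  norm_num

/-- `u ≠ 0` over any nontrivial target of `ℝ≥0`/`ℝ`: checked over `ℝ`. [folklore] -/
theorem tu_ne_zero : tu ℝ ≠ 0 := fun h => by
  have := eval_one_tu
  rw [h, map_zero] at this
  norm_num at this

/-- [folklore] -/
theorem tu'_ne_zero : tu' ℝ ≠ 0 := fun h => by
  have := eval_one_tu'
  rw [h, map_zero] at this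
  norm_num at this

/-- `per₃ ∤ u`. [folklore] -/
theorem not_perPoly_dvd_tu : ¬ perPoly (Fin 3) ℝ ∣ tu ℝ :=
  not_perPoly_dvd_of_degreeOf_eq_zero tu_ne_zero _ degreeOf_tu

/-- `per₃ ∤ u'`. [folklore] -/
theorem not_perPoly_dvd_tu' : ¬ perPoly (Fin 3) ℝ ∣ tu' ℝ :=
  not_perPoly_dvd_of_degreeOf_eq_zero tu'_ne_zero _ degreeOf_tu'

/-- `per₃ ∤ u + c u'` for `c ≥ 0` (the sum misses `x₁₀` and is nonzero). [folklore] -/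
theorem not_perPoly_dvd_tu_add (c : ℝ) (hc : 0 ≤ c) : ¬ perPoly (Fin 3) ℝ ∣ tu ℝ + C c * tu' ℝ := by
  refine not_perPoly_dvd_of_degreeOf_eq_zero ?_ ((1 : Fin 3), (0 : Fin 3))
    (degreeOf_add_eq_zero _ degreeOf_tu (degreeOf_C_mul_eq_zero _ c degreeOf_tu'))
  intro h
  have h1 := congrArg (eval (fun _ => (1 : ℝ))) h
  rw [map_add, map_mul, eval_C, eval_one_tu, eval_one_tu', map_zero] at h1
  nlinarith

/-- `per₃ ∤ c x₀₀^m + x₁₀^m` for `c ≥ 0`, `m` arbitrary (misses `x₂₂`, nonzero). [folklore] -/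
theorem not_perPoly_dvd_binomial (c : ℝ) (hc : 0 ≤ c) (m : ℕ) :
    ¬ perPoly (Fin 3) ℝ ∣ C c * x ℝ 0 0 ^ m + x ℝ 1 0 ^ m := by
  refine not_perPoly_dvd_of_degreeOf_eq_zero ?_ ((2 : Fin 3), (2 : Fin 3))
    (degreeOf_add_eq_zero _ (degreeOf_C_mul_eq_zero _ c (degreeOf_pow_eq_zero _
      (degreeOf_X_of_ne _ (by decide)) m)) (degreeOf_pow_eq_zero _ (degreeOf_X_of_ne _ (by decide)) m))
  intro h
  have h1 := congrArg (eval (fun _ => (1 : ℝ))) h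
  simp only [map_add, map_mul, eval_C, map_pow, eval_X, one_pow, mul_one, map_zero] at h1
  linarith

end Real

/-! ### Homogeneity bookkeeping over `ℝ≥0` -/

section Homog

/-- `u` is a cubic form. [folklore] -/
theorem tu_isHomogeneous (R : Type*) [CommSemiring R] : (tu R).IsHomogeneous 3 := by
  unfold tu P00 P20 x
  exact ((isHomogeneous_X R _).mul (((isHomogeneous_X R _).mul (isHomogeneous_X R _)).add
    ((isHomogeneous_X R _).mul (isHomogeneous_X R _)))).add
    ((isHomogeneous_X R _).mul (((isHomogeneous_X R _).mul (isHomogeneous_X R _)).add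
    ((isHomogeneous_X R _).mul (isHomogeneous_X R _))))

/-- `u'` is a cubic form. [folklore] -/
theorem tu'_isHomogeneous (R : Type*) [CommSemiring R] : (tu' R).IsHomogeneous 3 := by
  unfold tu' P10 x
  exact (isHomogeneous_X R _).mul (((isHomogeneous_X R _).mul (isHomogeneous_X R _)).add
    ((isHomogeneous_X R _).mul (isHomogeneous_X R _)))

/-- `u ≠ 0` over `ℝ≥0`. [folklore] -/
theorem tu_nnreal_ne_zero : tu ℝ≥0 ≠ 0 := fun h => by
  have := map_tu (R := ℝ≥0) NNReal.toRealHom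
  rw [h, map_zero] at this
  exact tu_ne_zero this.symm

/-- `u' ≠ 0` over `ℝ≥0`. [folklore] -/
theorem tu'_nnreal_ne_zero : tu' ℝ≥0 ≠ 0 := fun h => by
  have := map_tu' (R := ℝ≥0) NNReal.toRealHom
  rw [h, map_zero] at this
  exact tu'_ne_zero this.symm

/-- [folklore] -/
theorem tu_isHomogeneous_totalDegree : (tu ℝ≥0).IsHomogeneous (tu ℝ≥0).totalDegree := by
  rw [(tu_isHomogeneous ℝ≥0).totalDegree tu_nnreal_ne_zero]
  exact tu_isHomogeneous ℝ≥0

/-- [folklore] -/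
theorem tu'_isHomogeneous_totalDegree : (tu' ℝ≥0).IsHomogeneous (tu' ℝ≥0).totalDegree := by
  rw [(tu'_isHomogeneous ℝ≥0).totalDegree tu'_nnreal_ne_zero]
  exact tu'_isHomogeneous ℝ≥0

/-- A power of a variable is homogeneous of its own total degree. [folklore] -/
theorem X_pow_isHomogeneous_totalDegree (v : Fin 3 × Fin 3) (m : ℕ) :
    ((X v : MvPolynomial (Fin 3 × Fin 3) ℝ≥0) ^ m).IsHomogeneous
      ((X v : MvPolynomial (Fin 3 × Fin 3) ℝ≥0) ^ m).totalDegree := by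
  rw [totalDegree_X_pow]
  simpa using (isHomogeneous_X ℝ≥0 v).pow m

end Homog

/-! ### The refutations -/

/-- **`deg Vᵢ < N` is load-bearing in `stub_twoTowerCollapse`.**  With the strict inequalities
`V₁.totalDegree < N`, `V₂.totalDegree < N` weakened to `≤ N`, the stub is false: `n = 3`, `N = 1`,
`V₁ = x₀₀`, `V₂ = x₁₀`, `u = x₀₀P₀₀ + x₂₀P₂₀`, `u' = x₀₀P₁₀` — then `V₁ u + V₂ u' = x₀₀ · per₃` but
`u`, `u'`, `u + c u'` miss the variable `x₁₀` and `c x₀₀ + x₁₀` misses `x₂₂`, so none is a multiple of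
`per₃` (`one_le_degreeOf_of_perPoly_dvd`). [folklore] -/
theorem twoTowerCollapse_false_without_strict :
    ¬ ∀ (n N : ℕ) (V₁ V₂ u u' : MvPolynomial (Fin n × Fin n) ℝ≥0), 3 ≤ n → V₁ ≠ 0 → V₂ ≠ 0 →
        V₁.IsHomogeneous V₁.totalDegree → V₂.IsHomogeneous V₂.totalDegree →
        u.IsHomogeneous u.totalDegree → u'.IsHomogeneous u'.totalDegree →
        V₁.totalDegree ≤ N → V₂.totalDegree ≤ N →
        perPoly (Fin n) ℝ ∣ MvPolynomial.map NNReal.toRealHom (V₁ * u ^ N + V₂ * u' ^ N) →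
        perPoly (Fin n) ℝ ∣ MvPolynomial.map NNReal.toRealHom u ∨
        perPoly (Fin n) ℝ ∣ MvPolynomial.map NNReal.toRealHom u' ∨
        (∃ c : ℝ≥0, 0 < c ∧ perPoly (Fin n) ℝ ∣ MvPolynomial.map NNReal.toRealHom (c • V₁ + V₂)) ∨
        (∃ c : ℝ≥0, 0 < c ∧ perPoly (Fin n) ℝ ∣ MvPolynomial.map NNReal.toRealHom (u + c • u')) := by
  intro H
  have hV : ∀ v : Fin 3 × Fin 3, ((X v : MvPolynomial (Fin 3 × Fin 3) ℝ≥0)).IsHomogeneous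
      (X v : MvPolynomial (Fin 3 × Fin 3) ℝ≥0).totalDegree := fun v => by
    simpa using X_pow_isHomogeneous_totalDegree v 1
  have hdeg : ∀ v : Fin 3 × Fin 3, (X v : MvPolynomial (Fin 3 × Fin 3) ℝ≥0).totalDegree ≤ 1 :=
    fun v => (totalDegree_X (R := ℝ≥0) v).le
  have hdvd : perPoly (Fin 3) ℝ ∣ MvPolynomial.map NNReal.toRealHom
      (x ℝ≥0 0 0 * tu ℝ≥0 ^ 1 + x ℝ≥0 1 0 * tu' ℝ≥0 ^ 1) := by
    rw [pow_one, pow_one, key_relation, map_mul, map_perPoly]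
    exact dvd_mul_left _ _
  rcases H 3 1 (x ℝ≥0 0 0) (x ℝ≥0 1 0) (tu ℝ≥0) (tu' ℝ≥0) le_rfl (X_ne_zero _) (X_ne_zero _)
      (hV _) (hV _) tu_isHomogeneous_totalDegree tu'_isHomogeneous_totalDegree (hdeg _) (hdeg _) hdvd
    with h | h | ⟨c, hc, h⟩ | ⟨c, hc, h⟩
  · rw [map_tu] at h
    exact not_perPoly_dvd_tu h
  · rw [map_tu'] at h
    exact not_perPoly_dvd_tu' h
  · apply not_perPoly_dvd_binomial (c : ℝ) c.coe_nonneg 1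
    simpa [smul_eq_C_mul, map_X] using h
  · apply not_perPoly_dvd_tu_add (c : ℝ) c.coe_nonneg
    simpa [smul_eq_C_mul, map_tu, map_tu'] using h

/-- The real cofactor exhibiting `x₀₀³ u³ + x₁₀³ u'³ ∈ (per₃)`: from `x₀₀ u + x₁₀ u' = x₀₀ per₃`,
`(x₀₀u)³ + (x₁₀u')³ = (x₀₀u + x₁₀u') · ((x₀₀u)² − (x₀₀u)(x₁₀u') + (x₁₀u')²)`. [folklore] -/
theorem cube_tower_eq :
    x ℝ 0 0 ^ 3 * tu ℝ ^ 3 + x ℝ 1 0 ^ 3 * tu' ℝ ^ 3 = perPoly (Fin 3) ℝ *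
      (x ℝ 0 0 * ((x ℝ 0 0 * tu ℝ) ^ 2 - (x ℝ 0 0 * tu ℝ) * (x ℝ 1 0 * tu' ℝ) + (x ℝ 1 0 * tu' ℝ) ^ 2)) := by
  have key := key_relation ℝ
  calc x ℝ 0 0 ^ 3 * tu ℝ ^ 3 + x ℝ 1 0 ^ 3 * tu' ℝ ^ 3
      = (x ℝ 0 0 * tu ℝ + x ℝ 1 0 * tu' ℝ) *
          ((x ℝ 0 0 * tu ℝ) ^ 2 - (x ℝ 0 0 * tu ℝ) * (x ℝ 1 0 * tu' ℝ) + (x ℝ 1 0 * tu' ℝ) ^ 2) := by ring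
    _ = (x ℝ 0 0 * perPoly (Fin 3) ℝ) *
          ((x ℝ 0 0 * tu ℝ) ^ 2 - (x ℝ 0 0 * tu ℝ) * (x ℝ 1 0 * tu' ℝ) + (x ℝ 1 0 * tu' ℝ) ^ 2) := by
          rw [key]
    _ = _ := by ring

/-- **Sharp for genuine towers too (`N = 3`).**  With `≤ N` in place of `< N` the stub fails at
`n = 3`, `N = 3`, `V₁ = x₀₀³`, `V₂ = x₁₀³` and the same bases: `x₀₀ u ≡ −x₁₀ u' (mod per₃)` cubes to
`x₀₀³u³ + x₁₀³u'³ ∈ (per₃)`, and again no disjunct holds.  The same works for every odd `N`, so the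
threshold `deg V < N` cannot be relaxed at any odd exponent. [folklore] -/
theorem twoTowerCollapse_false_without_strict_odd :
    ¬ ∀ (n N : ℕ) (V₁ V₂ u u' : MvPolynomial (Fin n × Fin n) ℝ≥0), 3 ≤ n → V₁ ≠ 0 → V₂ ≠ 0 →
        V₁.IsHomogeneous V₁.totalDegree → V₂.IsHomogeneous V₂.totalDegree →
        u.IsHomogeneous u.totalDegree → u'.IsHomogeneous u'.totalDegree →
        V₁.totalDegree ≤ N → V₂.totalDegree ≤ N → 2 ≤ N →
        perPoly (Fin n) ℝ ∣ MvPolynomial.map NNReal.toRealHom (V₁ * u ^ N + V₂ * u' ^ N) →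
        perPoly (Fin n) ℝ ∣ MvPolynomial.map NNReal.toRealHom u ∨
        perPoly (Fin n) ℝ ∣ MvPolynomial.map NNReal.toRealHom u' ∨
        (∃ c : ℝ≥0, 0 < c ∧ perPoly (Fin n) ℝ ∣ MvPolynomial.map NNReal.toRealHom (c • V₁ + V₂)) ∨
        (∃ c : ℝ≥0, 0 < c ∧ perPoly (Fin n) ℝ ∣ MvPolynomial.map NNReal.toRealHom (u + c • u')) := by
  intro H
  have hdeg : ∀ v : Fin 3 × Fin 3, ((X v : MvPolynomial (Fin 3 × Fin 3) ℝ≥0) ^ 3).totalDegree ≤ 3 :=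
    fun v => (totalDegree_X_pow (R := ℝ≥0) v 3).le
  have hdvd : perPoly (Fin 3) ℝ ∣ MvPolynomial.map NNReal.toRealHom
      (x ℝ≥0 0 0 ^ 3 * tu ℝ≥0 ^ 3 + x ℝ≥0 1 0 ^ 3 * tu' ℝ≥0 ^ 3) := by
    simp only [map_add, map_mul, map_pow, map_X, map_tu, map_tu']
    exact ⟨_, cube_tower_eq⟩
  rcases H 3 3 (x ℝ≥0 0 0 ^ 3) (x ℝ≥0 1 0 ^ 3) (tu ℝ≥0) (tu' ℝ≥0) le_rfl
      (pow_ne_zero _ (X_ne_zero _)) (pow_ne_zero _ (X_ne_zero _))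
      (X_pow_isHomogeneous_totalDegree _ 3) (X_pow_isHomogeneous_totalDegree _ 3)
      tu_isHomogeneous_totalDegree tu'_isHomogeneous_totalDegree (hdeg _) (hdeg _) (by norm_num) hdvd
    with h | h | ⟨c, hc, h⟩ | ⟨c, hc, h⟩
  · rw [map_tu] at h
    exact not_perPoly_dvd_tu h
  · rw [map_tu'] at h
    exact not_perPoly_dvd_tu' h
  · apply not_perPoly_dvd_binomial (c : ℝ) c.coe_nonneg 3
    simpa [smul_eq_C_mul, map_X] using h
  · apply not_perPoly_dvd_tu_add (c : ℝ) c.coe_nonneg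
    simpa [smul_eq_C_mul, map_tu, map_tu'] using h

/-- **Square descent has no cubic analogue.**  `stub_squareDescent` (`per_n ∣ Σ_t u_t² ⇒ per_n ∣ u_t`
over `ℝ`) rests on sums of real squares; for cubes it fails: `per₃ ∣ (x₀₀u)³ + (x₁₀u')³` while
`per₃ ∤ x₀₀ u`. [folklore] -/
theorem not_cubeDescent :
    ¬ ∀ (n : ℕ) (ι : Type) [Fintype ι] (w : ι → MvPolynomial (Fin n × Fin n) ℝ),
        perPoly (Fin n) ℝ ∣ ∑ t, w t ^ 3 → ∀ t, perPoly (Fin n) ℝ ∣ w t := by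
  intro H
  have hsum : ∑ t, (![x ℝ 0 0 * tu ℝ, x ℝ 1 0 * tu' ℝ] t) ^ 3 =
      x ℝ 0 0 ^ 3 * tu ℝ ^ 3 + x ℝ 1 0 ^ 3 * tu' ℝ ^ 3 := by
    rw [Fin.sum_univ_two]
    simp only [Matrix.cons_val_zero, Matrix.cons_val_one]
    ring
  have h := H 3 (Fin 2) ![x ℝ 0 0 * tu ℝ, x ℝ 1 0 * tu' ℝ] (by rw [hsum]; exact ⟨_, cube_tower_eq⟩) 0
  simp only [Matrix.cons_val_zero] at h
  refine not_perPoly_dvd_of_degreeOf_eq_zero (mul_ne_zero (X_ne_zero _) tu_ne_zero) ((1 : Fin 3), (0 : Fin 3))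
    (degreeOf_mul_eq_zero _ (degreeOf_X_of_ne _ (by decide)) degreeOf_tu) h

end Summit.ValiantsHypothesis.ValiantsHypothesis.Cruxes.PerCofactorDegreeReduction.Disproof

end
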